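import Literature.NumberTheory.EllipticCurves.BSDHeegnerPointsSignOddProofs
import Literature.NumberTheory.EllipticCurves.QuadraticTwistKroneckerEvenLFunctionProofs
import Literature.NumberTheory.QuadraticFields.KroneckerCharacterFourProofs
import HarnessLib

/-!
# `ord_{s=1} L(E/K, s) ≥ 1` under the Heegner hypothesis from modularity alone — all `K`

Fourth and last proof file of `Literature/NumberTheory/EllipticCurves/BSDHeegnerPoints.lean` for
the named fact `Literature.NumberTheory.EllipticCurves.one_le_analyticRankEK W N K` (Gross 1984, §5;
Gross–Zagier 1986, IV; Darmon 2004, §3.6): for `E/ℚ` of conductor `N` and `K` imaginary quadratic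
with every `p ∣ N` split in `K`, `L(E/K, s) = L(E, s) L(E^{(d_K)}, s)` vanishes (to odd order) at
`s = 1`.

`BSDHeegnerPointsSignOddProofs` treated odd `d_K`; here the Kronecker character is supplied for
**even** `d_K = 4m` (`m ≡ 2, 3 (mod 4)` squarefree, `Quadratic.isFundamentalDiscriminant_discr`):
the Dirichlet character `χ` mod `4|m| = |d_K|` with `χ(n) = (m / n)` for odd `n`
(`exists_dirichletCharacter_four_mul`, `KroneckerCharacterFourProofs`: quadratic, primitive,
`χ(−1) = −1` as `m < 0`, `χ(N) = 1` as every `p ∣ N` splits — `N` is odd because `2` ramifies),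
together with `aₙ(E^{(d_K)}) = χ(n) aₙ(E)` (`LFunction_quadraticTwist_apply_of_four_dvd_discr`,
whose ramified places, including `2`, come from the tree's Artin formalism for `E_K/K`).

Results:
* `exists_twistCharacter_of_four_dvd_discr`,
  `one_le_analyticRankEK_of_exists_isNewformOf_of_four_dvd_discr` — the even case;
* `one_le_analyticRankEK_of_exists_isNewformOf` — **for every `W`, `N`, `K`, the named fact
  `one_le_analyticRankEK W N K` follows from the Modularity Theorem `exists_isNewformOf`**
  (Breuil–Conrad–Diamond–Taylor 2001, Thm. A, with Carayol 1986) and nothing else: all of Gross's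
  §5 deduction (analytic continuation from the newform, parity from the functional equation, the
  sign `w(E) w(E^{(d_K)}) = −1` from Atkin–Lehner theory of the twisted newform and the Kronecker
  character) is a theorem of the tree. The discharge `one_le_analyticRankEK_holds` is thus exactly
  `one_le_analyticRankEK_of_exists_isNewformOf W N K exists_isNewformOf_holds` once the modularity
  fact is discharged.

Everything is proved; no named facts are introduced (D-0026).

## References

* [Gross1984] B. H. Gross, *Heegner points on `X₀(N)`*, in *Modular Forms* (R. A. Rankin, ed.),
  Ellis Horwood (1984), 87–105, §5.
* [GrossZagier1986] B. H. Gross, D. B. Zagier, Invent. Math. 84 (1986), 225–320, IV (0.1)–(0.2).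
* [Darmon2004] H. Darmon, *Rational points on modular elliptic curves*, CBMS 101 (2004), §3.6,
  Thm. 3.15, Thm. 3.17.
* [Cox2013] D. A. Cox, *Primes of the form x² + ny²*, 2nd ed. (2013), §1.C Lemma 1.14.
* [BCDTJAMS2001] C. Breuil, B. Conrad, F. Diamond, R. Taylor, JAMS 14 (2001), Thm. A.
-/

noncomputable section

open scoped Classical NumberTheorySymbols

open WeierstrassCurve NumberField IsDedekindDomain Rat.HeightOneSpectrum
  Literature.NumberTheory.QuadraticFields Literature.NumberTheory.EllipticCurves.ModularForms

universe u

namespace Literature.NumberTheory.EllipticCurves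

variable (W : WeierstrassCurve ℚ) (N : ℕ) (K : Type u) [Field K] [NumberField K]

/-- **The Kronecker character of `K` twists `E` into `E^{(d_K)}`, for even `d_K = 4m`.** Let
`E / ℚ` be an elliptic curve (model `W`, conductor `N_W`) and `K` an imaginary quadratic field with
`4 ∣ d_K` in which every prime dividing `N_W` splits. Then the Dirichlet character `χ` mod `4|m|`
with `χ(n) = (m / n)` for odd `n` (`m = d_K / 4`) is primitive quadratic with `(N_W, 4|m|) = 1`,
`aₙ(E^{(d_K)}) = χ(n) aₙ(E)` for all `n`, and `χ(−1) χ(N_W) = −1` — the hypothesis of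
`one_le_analyticRankEK_of_exists_isNewformOf_of_twistCharacter` (Gross 1984, §5; Gross–Zagier 1986,
IV (0.1); Darmon 2004, Thm. 3.17). [cite: Gross1984, §5] -/
theorem exists_twistCharacter_of_four_dvd_discr [W.IsElliptic] (hK : IsImaginaryQuadratic K)
    (hH : SatisfiesHeegnerHypothesis (W.conductorNorm ℤ) K) (h4 : 4 ∣ NumberField.discr K) :
    ∃ (m : ℕ) (_ : NeZero m) (χ : DirichletCharacter ℂ m), (W.conductorNorm ℤ).Coprime m ∧
      χ.IsQuadratic ∧ χ.IsPrimitive ∧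
      (∀ n : ℕ, ((W.quadraticTwist (NumberField.discr K : ℚ)).LFunction n : ℂ) =
        χ n * (W.LFunction n : ℂ)) ∧
      χ (-1) * χ (W.conductorNorm ℤ) = -1 := by
  have h2 : Module.finrank ℚ K = 2 := hK.1
  set D : ℤ := NumberField.discr K with hDdef
  have hD0 : D ≠ 0 := NumberField.discr_ne_zero K
  have hDneg : D < 0 := hK.discr_neg
  -- `D = 4m` with `m = D / 4 ≡ 2, 3 (mod 4)` squarefree
  obtain ⟨hD4, -, -⟩ | ⟨-, hm4, hsq⟩ := Quadratic.isFundamentalDiscriminant_discr (K := K) h2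
  · exfalso; omega
  have hDm : D = 4 * (D / 4) := (Int.mul_ediv_cancel' h4).symm
  have hm0 : D / 4 ≠ 0 := hsq.ne_zero
  have hmneg : D / 4 < 0 := by omega
  haveI : NeZero (4 * (D / 4).natAbs) := ⟨mul_ne_zero (by norm_num) (Int.natAbs_ne_zero.mpr hm0)⟩
  have hDabs : D.natAbs = 4 * (D / 4).natAbs := by
    conv_lhs => rw [hDm]
    rw [Int.natAbs_mul]
    rfl
  -- the character
  obtain ⟨χ, hχ⟩ := exists_dirichletCharacter_four_mul (D / 4) hm0
  -- `(N, 4|m|) = (N, |D|) = 1`, and good reduction at the primes dividing `D`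
  have hcop : (W.conductorNorm ℤ).Coprime (4 * (D / 4).natAbs) :=
    hDabs ▸ Literature.SatisfiesHeegnerHypothesis.coprime_discr h2 hH
  have hgood : ∀ v : HeightOneSpectrum (𝓞 ℚ), ((primesEquiv v : ℕ) : ℤ) ∣ D → W.HasGoodReductionAt v := by
    intro v hv
    by_contra hbad
    have hdvdN : (primesEquiv v : ℕ) ∣ W.conductorNorm ℤ := (W.dvd_conductorNorm_iff v).mpr hbad
    have hdvdD : (primesEquiv v : ℕ) ∣ 4 * (D / 4).natAbs := hDabs ▸ Int.natCast_dvd.mp hv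
    exact (primesEquiv v).2.one_lt.ne'
      (Nat.Coprime.eq_one_of_dvd (Nat.Coprime.coprime_dvd_left hdvdN hcop) hdvdD)
  have hNpos : 0 < W.conductorNorm ℤ := W.conductorNorm_pos_holds
  -- `N` is odd: `2 ∣ D` does not split in `K`
  have hNodd : Odd (W.conductorNorm ℤ) := by
    refine Nat.odd_iff.mpr (Nat.two_dvd_ne_zero.mp fun h2N ↦ ?_)
    have h2D := Literature.SatisfiesHeegnerHypothesis.not_dvd_discr h2 hH Nat.prime_two h2N
    exact h2D (dvd_trans ⟨2, by norm_num⟩ h4)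
  -- the coefficients of the twist, computed over a quadratic field of discriminant `D` in `Type`
  -- (the Artin formalism of the tree is stated in universe `0`; only `d_K` matters)
  have hcoeff : ∀ n : ℕ, (W.quadraticTwist (D : ℚ)).LFunction n =
      (if Even n then 0 else J(D / 4 | n)) * W.LFunction n := by
    obtain ⟨K₀, _, _, h2₀, hdisc₀⟩ :=
      Quadratic.exists_numberField_discr_eq (D := D) (Or.inr ⟨h4, hm4, hsq⟩)
    intro n
    have h := W.LFunction_quadraticTwist_apply_of_four_dvd_discr K₀ h2₀ (hdisc₀.symm ▸ h4)
      (fun v hv ↦ hgood v (hdisc₀ ▸ hv)) n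
    rwa [hdisc₀] at h
  refine ⟨4 * (D / 4).natAbs, inferInstance, χ, hcop, isQuadratic_of_forall_odd hm0 hχ,
    isPrimitive_of_forall_odd hm4 hsq hχ, fun n ↦ ?_, ?_⟩
  · rw [hcoeff n]
    by_cases hn : Even n
    · have hval : Even ((n : ZMod (4 * (D / 4).natAbs)).val) := by
        rw [ZMod.val_natCast, Nat.even_iff,
          Nat.mod_mod_of_dvd n (⟨2 * (D / 4).natAbs, by ring⟩ : 2 ∣ 4 * (D / 4).natAbs)]
        exact Nat.even_iff.mp hn
      rw [if_pos hn, apply_eq_zero_of_even (χ := χ) hval, Int.cast_mul, Int.cast_zero, zero_mul]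
    · rw [if_neg hn, hχ n (Nat.not_even_iff_odd.mp hn), Int.cast_mul]
  · -- the sign
    rw [apply_neg_one_of_forall_odd hmneg hm4 hχ,
      apply_natCast_eq_one_of_forall_prime hχ hNodd fun p hp hpN ↦ ?_]
    · norm_num
    · -- `(m / p) = (D / p) = 1` for the odd primes `p ∣ N` (they split in `K`)
      have hp2 : p ≠ 2 := by
        rintro rfl
        exact (Nat.not_even_iff_odd.mpr hNodd) (even_iff_two_dvd.mpr hpN)
      haveI := Fact.mk hp
      have hJ := Literature.SatisfiesHeegnerHypothesis.jacobiSym_discr_eq_one h2 hH hp hpN hp2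
      rw [← hDdef] at hJ
      rw [hDm, jacobiSym.mul_left, show (4 : ℤ) = 2 ^ 2 by norm_num,
        jacobiSym.sq_one' (by
          rw [Int.gcd_comm, Int.gcd_eq_natAbs, Int.natAbs_natCast]
          exact (Nat.coprime_primes hp Nat.prime_two).mpr hp2), one_mul] at hJ
      exact hJ

/-- **`one_le_analyticRankEK W N K` from the Modularity Theorem, for even `d_K`** (Gross 1984,
§5; Gross–Zagier 1986, IV; Darmon 2004, §3.6). [cite: Gross1984, §5] -/
theorem one_le_analyticRankEK_of_exists_isNewformOf_of_four_dvd_discr (hmod : exists_isNewformOf)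
    (h4 : 4 ∣ NumberField.discr K) : one_le_analyticRankEK W N K :=
  one_le_analyticRankEK_of_exists_isNewformOf_of_twistCharacter W N K hmod
    fun hK hH ↦ exists_twistCharacter_of_four_dvd_discr W K hK hH h4

/-- **The named fact `one_le_analyticRankEK W N K` from the Modularity Theorem alone** (Gross 1984,
§5; Gross–Zagier 1986, IV (0.1)–(0.2); Darmon 2004, §3.6, Thm. 3.15 and Thm. 3.17): assume
`exists_isNewformOf` — every elliptic curve over `ℚ` has a newform `f ∈ S₂(Γ₀(N_E))` with
`aₙ(f) = aₙ(E)` (Wiles 1995; Taylor–Wiles 1995; Breuil–Conrad–Diamond–Taylor 2001, Thm. A; level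
`= N_E` by Carayol 1986). Then for `W / ℚ` elliptic of conductor `N` and `K` imaginary quadratic in
which every prime dividing `N` splits, `1 ≤ ord_{s=1} L(E, s) L(E^{(d_K)}, s)`. The discriminant
`d_K` is odd or divisible by `4` (`Quadratic.isFundamentalDiscriminant_discr`), and the two cases
are `one_le_analyticRankEK_of_exists_isNewformOf_of_odd_discr` and `…_of_four_dvd_discr`. Hence the
discharge `one_le_analyticRankEK_holds` reduces to the single named fact `exists_isNewformOf` of the
tree. [cite: Gross1984, §5] [cite: Darmon2004, §3.6, Thm. 3.15 and Thm. 3.17] -/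
theorem one_le_analyticRankEK_of_exists_isNewformOf (hmod : exists_isNewformOf) :
    one_le_analyticRankEK W N K :=
  one_le_analyticRankEK_of_exists_isNewformOf_of_twistCharacter W N K hmod fun hK hH ↦ by
    rcases Quadratic.isFundamentalDiscriminant_discr (K := K) hK.1 with ⟨hD4, -, -⟩ | ⟨h4, -, -⟩
    · exact exists_twistCharacter_of_odd_discr W K hK hH (Int.odd_iff.mpr (by omega))
    · exact exists_twistCharacter_of_four_dvd_discr W K hK hH h4

end Literature.NumberTheory.EllipticCurves

end
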